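import Literature.AlgebraicGeometry.HodgeTheory.WeilClassesRationalPlane
import Literature.AlgebraicGeometry.HodgeTheory.WeilClassesMoonenZarhinCriterion
import Literature.AlgebraicGeometry.HodgeTheory.WeilClassesFieldRationalSpan
import Literature.AlgebraicGeometry.HodgeTheory.WeilClassesFieldSplitSquareZetaEight
import Literature.AlgebraicGeometry.HodgeTheory.HodgeTypeProjectors
import Literature.AlgebraicGeometry.HodgeTheory.HodgeTypeVanishing
import Literature.AlgebraicGeometry.HodgeTheory.AbelJacobiPullbackHodgeSection
import Mathlib.RingTheory.PrincipalIdealDomain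
import Mathlib.LinearAlgebra.Semisimple
import Mathlib.LinearAlgebra.Eigenspace.Semisimple
import Mathlib.LinearAlgebra.Eigenspace.Minpoly
import Mathlib.FieldTheory.IsAlgClosed.Basic
import Mathlib.FieldTheory.Perfect
import Mathlib.RingTheory.AdjoinRoot
import Mathlib.LinearAlgebra.Charpoly.ToMatrix
import Mathlib.LinearAlgebra.Matrix.Charpoly.Coeff
import Mathlib.FieldTheory.Minpoly.Field
import Mathlib.Analysis.Complex.Polynomial.Basic
import HarnessLib

/-!
# Moonen–Zarhin's Hodge criterion for Weil classes — DISCHARGE of the named fact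

Layer `Literature/AlgebraicGeometry/HodgeTheory`. The named fact
`MoonenZarhin1998_weilClasses_hodgeCriterion` (file `WeilClassesMoonenZarhinCriterion`; Moonen–Zarhin,
*Weil classes on abelian varieties*, J. reine angew. Math. 496 (1998) = arXiv:alg-geom/9612017, §1,
Criterion: "If `n_σ = n_{σ′}` for all `σ ∈ Σ_F` then `W_F` consists entirely of Hodge classes; if
`n_σ ≠ n_{σ′}` for some `σ ∈ Σ_F` then the zero class is the only Hodge class in `W_F`") is PROVED
here on the tree's carriers, as `MoonenZarhin1998_weilClasses_hodgeCriterion_holds`, with no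
hypothesis added and none removed (the quadratic case `[F:ℚ] = 2` is the tree's
`isOfHodgeType_of_mem_weilClassesOf` / `finrank_eq_of_mem_weilClassesOf`, Deligne–Milne Prop. 4.4).

## The printed proof and its rendering

Print (loc. cit. §1): `W_F ⊗ ℂ = ⊕_σ ⋀^r_ℂ V_{ℂ,σ} = ⊕_σ (⋀^{n_σ} V^{1,0}_{ℂ,σ} ⊗ ⋀^{n_{σ′}} V^{0,1}_{ℂ,σ})`,
so the summand at `σ` is a LINE of pure Hodge type `(n_σ, n_{σ′})`, `n_σ + n_{σ′} = r`; "In view of the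
remarks in section (allornothing)" — `F^×` acts on the one-dimensional `F`-space `W_F`, so "either all
elements of `W_F` are Hodge classes, or `0 ∈ W_F` is the only Hodge class" — the Criterion follows.
On the carriers (`F = ℚ(φ) = ℚ[T]/(P)`, `P ∈ ℤ[T]` monic irreducible of degree `e`, `P(φ) = 0`,
`e · r = 2 dim A`, roots `ρ ↔ σ`, `V_ρ = ker(φ^* - ρ)`, `n_ρ = eigenMultiplicity A φ ρ`):

* `finrank_eigenspace_mul_natDegree_eq` / `finrank_eigenspace_eq_of_root` /
  `eigenMultiplicity_add_eigenMultiplicity_conj_eq` — **`dim V_ρ = r`, `n_ρ + n_ρ̄ = r`** for every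
  root (Moonen–Zarhin: "`n_σ + n_{σ′} = 2g/[F:ℚ]`"; Deligne–Milne (4.4) `dim H_{B,σ} = d`): the
  characteristic polynomial of `φ^*` on `H¹` is RATIONAL (matrix of `φ^*` in a basis of rational
  classes, `repr_mem_range_ratCast_of_isRationalClass`; `exists_charpoly_map_one_eq_map`), monic with
  all complex roots among the roots of the irreducible `P_ℚ`, hence `= P_ℚ^m`
  (`eq_pow_of_forall_aeval_eq_zero`); in an eigenbasis it is `∏_ρ (X - ρ)^{dim V_ρ}`, so `dim V_ρ = m`
  and `m · e = 2 dim A`.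
* `exists_generator_pullbackEigenclasses_of_root` — **the summand `⋀ʳ V_ρ = pullbackEigenclasses A φ r ((x+yρ)ʳ)`
  is the line `ℂ · ω_ρ`, `ω_ρ = u₁ ⌣ ⋯ ⌣ u_{n_ρ} ⌣ v₁ ⌣ ⋯ ⌣ v_{n_ρ̄} ≠ 0` of pure type `(n_ρ, n_ρ̄)`**
  (`dim V_ρ = r` by `finrank_eigenspace_eq_of_root`;
  `V_ρ = (V_ρ ∩ H^{1,0}) ⊕ (V_ρ ∩ H^{0,1})` of dimensions `n_ρ`, `n_ρ̄`, file `DegreeOneHodgeTypes`; the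
  cup product adds types, `isOfHodgeType_cupPowOne`; the line bound `finrank_pullbackEigenclasses_pow_le_one`).
* Part (i) `isOfHodgeType_of_mem_weilClassesField_of_balanced`: if `n_ρ = n_ρ̄` for all roots then
  `n_ρ = r/2` and `W_F ⊗ ℂ = ⊕ ℂ ω_ρ` is of type `(r/2, r/2)`.
* Part (ii) `eq_zero_of_mem_weilClassesField_of_unbalanced` — the "all or nothing" step WITHOUT a
  Galois action on cohomology: a RATIONAL `(r/2, r/2)`-class `c = Σ_ρ c_ρ ∈ W_F ⊗ ℂ` has `c_{ρ₁} = 0`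
  at an unbalanced root `ρ₁` (type projectors, `HodgeModel.typeProj_eq_of_sum_eq`: the component of
  `c` of type `(n_{ρ₁}, n_{ρ̄₁}) ≠ (r/2, r/2)` vanishes, and the `c_ρ` are eigenvectors of ONE rational
  test operator `T₀ = (x₀·𝟙 + φ)^*` for distinct eigenvalues `(x₀ + ρ)ʳ`); and **a rational class of
  `W_F ⊗ ℂ` with one vanishing component is zero** (`eq_zero_of_isRationalClass_of_eigencomponent_eq_zero`):
  the complex annihilator `∏_{ρ ≠ ρ₁} (X - (x₀+ρ)ʳ)` of `c` in `T₀` has a RATIONAL shadow `Q_φ ≠ 0` of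
  degree `< e` killing `c` (rational classes form a `ℚ`-structure: `sum_dual_smul_eq_zero_of_isRationalClass`),
  while the irreducible `M = minpoly_ℚ((x₀ + T)ʳ)` of degree `≥ e` also kills `c`
  (`aeval_minpoly_pow_eq_zero`, file `WeilClassesFieldRationalSpan`); `M` and `Q_φ` are coprime, so
  `c = (aM + bQ_φ)(T₀) c = 0`. This is the `F^×`-module argument of print in coordinates: a non-zero
  `F`-stable rational line meets every summand.

Everything is proved; no definition, no new named fact (D-0026); net effect: the named fact
`MoonenZarhin1998_weilClasses_hodgeCriterion` is DISCHARGED (`_holds`).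

## References

* [MoonenZarhin1998WeilClasses] B. J. J. Moonen, Yu. G. Zarhin, *Weil classes on abelian
  varieties*, J. reine angew. Math. 496 (1998) 83–92 = arXiv:alg-geom/9612017, §1 (Criterion, the
  display `W_F ⊗ ℂ = ⊕_σ ⋀^{n_σ} V^{1,0} ⊗ ⋀^{n_σ′} V^{0,1}`, section "all or nothing").
* [Deligne1982HodgeCycles] P. Deligne (notes by J. S. Milne), LNM 900 (1982), §4 (4.4), Prop. 4.4.
* [vanGeemen1994HodgeAV] B. van Geemen, LNM 1594 (1994), 4.9–4.10, proof of Lemma 5.2 (6).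
* [LangeBirkenhake1992] H. Lange, Ch. Birkenhake, *Complex Abelian Varieties* (1992), §1.1–1.2 (the
  rational representation `ρ_r`; Prop. 1.2.3).
* [VoisinHodgeI2002] C. Voisin, *Hodge Theory and Complex Algebraic Geometry I* (2002), Thm. 6.18,
  §7.1.1–7.1.2.
-/

noncomputable section

open CategoryTheory Polynomial

universe u

namespace Literature.AlgebraicGeometry.HodgeTheory

section HodgeTheory

open Literature.AlgebraicTopology.SingularHomology
open Literature.AlgebraicGeometry.Motives (IsSmoothProjective)

/-! ### A monic rational polynomial whose complex roots are roots of an irreducible `P` is a power of `P` -/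

section Powers

/-- **A monic `Q ∈ ℚ[X]` all of whose complex roots are roots of the monic irreducible `P ∈ ℚ[X]` is
`P^m` for some `m`**: if `deg Q > 0`, a complex root `z` of `Q` has `minpoly_ℚ z = P`, so `P ∣ Q`;
induct on the degree. [folklore] -/
theorem eq_pow_of_forall_aeval_eq_zero {P Q : Polynomial ℚ} (hPirr : Irreducible P) (hPm : P.Monic)
    (hQm : Q.Monic) (hQ : ∀ z : ℂ, aeval z Q = 0 → aeval z P = 0) : ∃ m : ℕ, Q = P ^ m := by
  induction hN : Q.natDegree using Nat.strong_induction_on generalizing Q with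
  | _ N ih =>
    by_cases hN0 : Q.natDegree = 0
    · exact ⟨0, by rw [pow_zero]; exact Polynomial.eq_one_of_monic_natDegree_zero hQm hN0⟩
    · -- a complex root `z` of `Q`, and `P = minpoly_ℚ z ∣ Q`
      have hdeg : 0 < degree (Q.map (algebraMap ℚ ℂ)) := by
        rw [degree_map]
        exact natDegree_pos_iff_degree_pos.1 (Nat.pos_of_ne_zero hN0)
      obtain ⟨z, hz⟩ := Complex.exists_root hdeg
      have hzQ : aeval z Q = 0 := by rwa [IsRoot.def, Polynomial.eval_map, ← aeval_def] at hz
      have hPmin : P = minpoly ℚ z := minpoly.eq_of_irreducible_of_monic hPirr (hQ z hzQ) hPm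
      have hdvd : P ∣ Q := by rw [hPmin]; exact minpoly.dvd ℚ z hzQ
      obtain ⟨Q', hQ'⟩ := hdvd
      have hQ'm : Q'.Monic := hPm.of_mul_monic_left (hQ' ▸ hQm)
      have hP1 : 0 < P.natDegree := natDegree_pos_iff_degree_pos.2 (degree_pos_of_irreducible hPirr)
      have hdeg' : Q'.natDegree < N := by
        have h := Polynomial.natDegree_mul hPm.ne_zero hQ'm.ne_zero
        rw [← hQ', hN] at h
        omega
      have hroots' : ∀ z : ℂ, aeval z Q' = 0 → aeval z P = 0 := fun z hz =>
        hQ z (by rw [hQ', map_mul, hz, mul_zero])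
      obtain ⟨m, hm⟩ := ih Q'.natDegree hdeg' hQ'm hroots' rfl
      exact ⟨m + 1, by rw [hQ', hm, pow_succ']⟩

end Powers

/-! ### The characteristic polynomial of `f^*` on `H¹(A(ℂ); ℂ)` is rational -/

section Charpoly

variable {A : Motives.AbelianVariety ℂ}

/-- **The characteristic polynomial of `f^*` on `H¹(A(ℂ); ℂ)` has rational coefficients** (and is
monic of degree `b₁ = 2 dim A`) for every endomorphism `f` of a complex abelian variety: in a
`ℂ`-basis of `H¹` consisting of rational classes (they span, `span_isRationalClass_eq_top_of_isSmoothProjective_holds`)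
the matrix of `f^*` has rational entries (`repr_mem_range_ratCast_of_isRationalClass`; the mechanism
of `trace_map_one_mem_range_ratCast`) — Lange–Birkenhake's rational representation `ρ_r`.
[cite: LangeBirkenhake1992, §1.2 Prop. 1.2.3] -/
theorem exists_charpoly_map_one_eq_map (f : A ⟶ A) [Module.Finite ℂ (complexBetti A.X 1)] :
    ∃ C : Polynomial ℚ, C.Monic ∧ C.natDegree = 2 * A.dim ∧
      (complexBetti.map f.hom.hom.hom 1).hom.charpoly = C.map (algebraMap ℚ ℂ) := by
  classical
  obtain ⟨t, hts, htspan, hli⟩ :=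
    exists_linearIndependent ℂ {c : complexBetti A.X 1 | IsRationalClass c}
  have hspan : Submodule.span ℂ {c : complexBetti A.X 1 | IsRationalClass c} = ⊤ :=
    span_isRationalClass_eq_top_of_isSmoothProjective_holds _ _
      (Motives.AbelianVariety.isSmoothProjective_holds (A := A)) 1
  haveI : Fintype t := (hli.set_finite_of_isNoetherian).fintype
  let b : Module.Basis t ℂ (complexBetti A.X 1) :=
    Module.Basis.mk hli (by rw [Subtype.range_coe, htspan, hspan])
  have hb : ∀ i, IsRationalClass (b i) := fun i => by
    rw [Module.Basis.mk_apply]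
    exact hts i.2
  set F := (complexBetti.map f.hom.hom.hom 1).hom with hFdef
  have hentry : ∀ i j, ∃ q : ℚ, (q : ℂ) = LinearMap.toMatrix b b F i j := fun i j => by
    rw [LinearMap.toMatrix_apply]
    obtain ⟨q, hq⟩ := repr_mem_range_ratCast_of_isRationalClass b hb ((hb j).pullback _) i
    exact ⟨q, hq⟩
  choose Mq hMq using hentry
  have hM : (Matrix.of fun i j => Mq i j).map (algebraMap ℚ ℂ) = LinearMap.toMatrix b b F := by
    ext i j
    rw [Matrix.map_apply, Matrix.of_apply, eq_ratCast, hMq]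
  refine ⟨(Matrix.of fun i j => Mq i j).charpoly, Matrix.charpoly_monic _, ?_, ?_⟩
  · rw [Matrix.charpoly_natDegree_eq_dim, ← Module.finrank_eq_card_basis b,
      Motives.AbelianVariety.finrank_complexBetti_one]
  · rw [← Matrix.charpoly_map, hM, LinearMap.charpoly_toMatrix]

end Charpoly

/-! ### `dim V_ρ · deg P = 2 dim A` -/

section Multiplicity

variable {A : Motives.AbelianVariety ℂ}

/-- **Equal multiplicities of the conjugate eigenvalues** (Moonen–Zarhin §1: "`n_σ + n_{σ′} = 2g/[F:ℚ]`
for all `σ ∈ Σ_F`"; Deligne–Milne (4.4): `dim H_{B,σ} = d`, `d[E:ℚ] = 2 dim A`): for a complex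
abelian variety `A`, `φ : A ⟶ A` and `P ∈ ℤ[T]` monic, irreducible over `ℚ`, with `P(φ) = 0` in
`End A`, every complex root `ρ` of `P` satisfies `dim_ℂ ker(φ^* - ρ)|_{H¹(A(ℂ);ℂ)} · deg P = 2 dim A`.
Proof in the module docstring (rational characteristic polynomial `= P_ℚ^m`).
[cite: MoonenZarhin1998WeilClasses, §1 (n_σ + n_σ' = 2g/[F:ℚ])] [cite: Deligne1982HodgeCycles, §4 (4.4)] -/
theorem finrank_eigenspace_mul_natDegree_eq {φ : A ⟶ A} {P : Polynomial ℤ} (hPm : P.Monic)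
    (hPirr : Irreducible (P.map (Int.castRingHom ℚ)))
    (hφ : Polynomial.eval₂ (Int.castRingHom (CategoryTheory.End A)) (φ : CategoryTheory.End A) P = 0)
    {ρ : ℂ} (hρ : Polynomial.eval₂ (Int.castRingHom ℂ) ρ P = 0) :
    Module.finrank ℂ (Module.End.eigenspace (complexBetti.map φ.hom.hom.hom 1).hom ρ) * P.natDegree =
      2 * A.dim := by
  classical
  haveI := finite_complexBetti_abelianVariety A 1
  set F : Module.End ℂ (complexBetti A.X 1) := (complexBetti.map φ.hom.hom.hom 1).hom with hFdef
  have hPQm : (P.map (Int.castRingHom ℚ)).Monic := hPm.map _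
  have hP0 : P ≠ 0 := hPm.ne_zero
  have hPC0 : P.map (Int.castRingHom ℂ) ≠ 0 :=
    (Polynomial.map_ne_zero_iff (RingHom.injective_int (Int.castRingHom ℂ))).2 hP0
  -- semisimplicity of `φ^*` and the eigenspace decomposition
  have hsepC : (P.map (Int.castRingHom ℂ)).Separable := by
    rw [map_castRingHom_complex_eq]; exact hPirr.separable.map
  have hF : aeval F (P.map (Int.castRingHom ℂ)) = 0 := aeval_hom_complexBetti_map_one_eq_zero hφ
  have hss : F.IsSemisimple :=
    Module.End.isSemisimple_of_squarefree_aeval_eq_zero hsepC.squarefree hF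
  have htop : ⨆ μ, F.eigenspace μ = ⊤ := hss.iSup_eigenspace_eq_top
  have hroot : ∀ μ, F.eigenspace μ ≠ ⊥ → Polynomial.eval₂ (Int.castRingHom ℂ) μ P = 0 := by
    intro μ hμ
    obtain ⟨v, hv, hv0⟩ := (Submodule.ne_bot_iff _).1 hμ
    have h := Module.End.aeval_apply_of_hasEigenvector (f := F) (p := P.map (Int.castRingHom ℂ))
      (Module.End.hasEigenvector_iff.2 ⟨hv, hv0⟩)
    rw [hF, LinearMap.zero_apply, Polynomial.eval_map] at h
    exact (smul_eq_zero.1 h.symm).resolve_right hv0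
  let Z : Finset ℂ := (P.map (Int.castRingHom ℂ)).roots.toFinset
  have hZ : ∀ μ, μ ∈ Z ↔ Polynomial.eval₂ (Int.castRingHom ℂ) μ P = 0 := mem_roots_toFinset_map_iff hP0
  let V : Z → Submodule ℂ (complexBetti A.X 1) := fun ρ => F.eigenspace (ρ : ℂ)
  have hind : iSupIndep V := (Module.End.eigenspaces_iSupIndep F).comp Subtype.val_injective
  have hsup : iSup V = ⊤ := by
    refine le_antisymm le_top ?_
    rw [← htop]
    refine iSup_le fun μ => ?_
    by_cases hμ : F.eigenspace μ = ⊥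
    · rw [hμ]; exact bot_le
    · exact le_iSup V ⟨μ, (hZ μ).2 (hroot μ hμ)⟩
  have hint : DirectSum.IsInternal V := DirectSum.isInternal_submodule_of_iSupIndep_of_iSup_eq_top hind hsup
  -- an eigenbasis indexed by `Σ ρ ∈ Z, Fin (dim V_ρ)`
  let b := hint.collectedBasis fun ρ => Module.finBasis ℂ (V ρ)
  have hb_mem : ∀ s : (Σ ρ : Z, Fin (Module.finrank ℂ (V ρ))), b s ∈ F.eigenspace (s.1 : ℂ) :=
    fun s => hint.collectedBasis_mem _ s
  have hdiag : LinearMap.toMatrix b b F =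
      Matrix.diagonal fun s : (Σ ρ : Z, Fin (Module.finrank ℂ (V ρ))) => ((s.1 : ℂ)) := by
    ext s s'
    rw [LinearMap.toMatrix_apply, Module.End.mem_eigenspace_iff.1 (hb_mem s'), map_smul, b.repr_self,
      Matrix.diagonal_apply, Finsupp.smul_apply, Finsupp.single_apply, smul_eq_mul]
    by_cases h : s = s'
    · subst h
      rw [if_pos rfl, if_pos rfl, mul_one]
    · have h' : ¬ s' = s := fun e => h e.symm
      rw [if_neg h', if_neg h, mul_zero]
  have hchar : F.charpoly = ∏ s : (Σ ρ : Z, Fin (Module.finrank ℂ (V ρ))), (X - C ((s.1 : ℂ))) := by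
    rw [← LinearMap.charpoly_toMatrix F b, hdiag, Matrix.charpoly_diagonal]
  -- the rational characteristic polynomial is `P_ℚ^m`
  obtain ⟨Cq, hCqm, hCqdeg, hCq⟩ := exists_charpoly_map_one_eq_map φ
  have hCroots : ∀ z : ℂ, aeval z Cq = 0 → aeval z (P.map (Int.castRingHom ℚ)) = 0 := by
    intro z hz
    rw [aeval_def, ← Polynomial.eval_map, ← hCq, ← hFdef, hchar, eval_prod] at hz
    obtain ⟨s, -, hs⟩ := Finset.prod_eq_zero_iff.1 hz
    rw [eval_sub, eval_X, eval_C, sub_eq_zero] at hs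
    rw [hs, aeval_map_castRingHom_rat]
    exact (hZ _).1 s.1.2
  obtain ⟨m, hm⟩ := eq_pow_of_forall_aeval_eq_zero hPirr hPQm hCqm hCroots
  have hdegP : (P.map (Int.castRingHom ℚ)).natDegree = P.natDegree :=
    natDegree_map_eq_of_injective (RingHom.injective_int _) P
  have hme : m * P.natDegree = 2 * A.dim := by
    rw [← hCqdeg, hm, natDegree_pow, hdegP]
  -- the multiplicity of `ρ` on the diagonal is `m`
  have hcount : (Finset.univ.filter fun s : (Σ ρ : Z, Fin (Module.finrank ℂ (V ρ))) =>
      ρ = (s.1 : ℂ)).card = m := by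
    have h1 : F.charpoly.roots =
        Finset.univ.val.map fun s : (Σ ρ : Z, Fin (Module.finrank ℂ (V ρ))) => ((s.1 : ℂ)) := by
      have hcomp : (fun s : (Σ ρ : Z, Fin (Module.finrank ℂ (V ρ))) => (X - C ((s.1 : ℂ)) : ℂ[X])) =
          (fun a : ℂ => X - C a) ∘ fun s : (Σ ρ : Z, Fin (Module.finrank ℂ (V ρ))) => ((s.1 : ℂ)) := rfl
      rw [hchar, Finset.prod_eq_multiset_prod, hcomp, ← Multiset.map_map, roots_multiset_prod_X_sub_C]
    have h2 : F.charpoly.roots = m • (P.map (Int.castRingHom ℂ)).roots := by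
      rw [hFdef, hCq, hm, Polynomial.map_pow, roots_pow, ← map_castRingHom_complex_eq]
    have h3 : Multiset.count ρ F.charpoly.roots = (Finset.univ.filter
        fun s : (Σ ρ : Z, Fin (Module.finrank ℂ (V ρ))) => ρ = (s.1 : ℂ)).card := by
      rw [h1, Multiset.count_map, Finset.card_def, Finset.filter_val]
    have h4 : Multiset.count ρ F.charpoly.roots = m := by
      rw [h2, Multiset.count_nsmul, Multiset.count_eq_one_of_mem (nodup_roots hsepC)
        ((mem_roots hPC0).2 (by rw [IsRoot.def, Polynomial.eval_map]; exact hρ)), mul_one]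
    rw [← h3, h4]
  -- the fiber of `ρ` in the index type has `dim V_ρ` elements
  have hρZ : ρ ∈ Z := (hZ ρ).2 hρ
  have hfib : (Finset.univ.filter fun s : (Σ ρ : Z, Fin (Module.finrank ℂ (V ρ))) =>
      ρ = (s.1 : ℂ)).card = Module.finrank ℂ (F.eigenspace ρ) := by
    rw [Finset.card_eq_sum_ones, Finset.sum_filter, Fintype.sum_sigma]
    have hinner : ∀ a : Z, (∑ _i : Fin (Module.finrank ℂ (V a)), if ρ = (a : ℂ) then (1 : ℕ) else 0) =
        if (⟨ρ, hρZ⟩ : Z) = a then Module.finrank ℂ (V a) else 0 := by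
      intro a
      rw [Finset.sum_const, Finset.card_univ, Fintype.card_fin, smul_eq_mul]
      by_cases ha : (⟨ρ, hρZ⟩ : Z) = a
      · rw [if_pos ha, if_pos (congrArg Subtype.val ha), mul_one]
      · have ha' : ¬ ρ = (a : ℂ) := fun e => ha (Subtype.ext e)
        rw [if_neg ha, if_neg ha', mul_zero]
    rw [Finset.sum_congr rfl (fun a _ => hinner a), Finset.sum_ite_eq, if_pos (Finset.mem_univ _)]
  -- conclude
  rw [← hfib, hcount, hme]

/-- **`dim V_ρ = r = 2 dim A / e`** in Moonen–Zarhin's normalisation: `P` monic irreducible of degree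
`e` with `P(φ) = 0` and `e · r = 2 dim A`; then every complex root `ρ` of `P` has
`dim_ℂ ker(φ^* - ρ)|_{H¹} = r` ("`n_σ + n_{σ′} = 2g/[F:ℚ]`").
[cite: MoonenZarhin1998WeilClasses, §1 (n_σ + n_σ' = 2g/[F:ℚ])] [cite: Deligne1982HodgeCycles, §4 (4.4)] -/
theorem finrank_eigenspace_eq_of_root {φ : A ⟶ A} {P : Polynomial ℤ} {e r : ℕ} (hPm : P.Monic)
    (hPe : P.natDegree = e) (hPirr : Irreducible (P.map (Int.castRingHom ℚ)))
    (hφ : Polynomial.eval₂ (Int.castRingHom (CategoryTheory.End A)) (φ : CategoryTheory.End A) P = 0)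
    (her : e * r = 2 * A.dim) {ρ : ℂ} (hρ : Polynomial.eval₂ (Int.castRingHom ℂ) ρ P = 0) :
    Module.finrank ℂ (Module.End.eigenspace (complexBetti.map φ.hom.hom.hom 1).hom ρ) = r := by
  have h := finrank_eigenspace_mul_natDegree_eq hPm hPirr hφ hρ
  rw [hPe, ← her, mul_comm e r] at h
  have he : 0 < e := by
    rw [← hPe, ← natDegree_map_eq_of_injective (RingHom.injective_int (Int.castRingHom ℚ)) P]
    exact natDegree_pos_iff_degree_pos.2 (degree_pos_of_irreducible hPirr)
  exact Nat.eq_of_mul_eq_mul_right he h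

/-- **`n_ρ + n_ρ̄ = r`**: with `n_ρ = eigenMultiplicity A φ ρ = dim (V_ρ ∩ H^{1,0})` (file
`WeilClassesMoonenZarhinCriterion`), the two multiplicities at conjugate roots add up to
`r = 2 dim A / e` — `dim V_ρ = dim (V_ρ ∩ H^{1,0}) + dim (V_ρ ∩ H^{0,1})` and
`dim (V_ρ ∩ H^{0,1}) = dim (V_ρ̄ ∩ H^{1,0})` (conjugation; file `DegreeOneHodgeTypes`).
[cite: MoonenZarhin1998WeilClasses, §1 (n_σ + n_σ' = 2g/[F:ℚ])] -/
theorem eigenMultiplicity_add_eigenMultiplicity_conj_eq {φ : A ⟶ A} {P : Polynomial ℤ} {e r : ℕ}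
    (hPm : P.Monic) (hPe : P.natDegree = e) (hPirr : Irreducible (P.map (Int.castRingHom ℚ)))
    (hφ : Polynomial.eval₂ (Int.castRingHom (CategoryTheory.End A)) (φ : CategoryTheory.End A) P = 0)
    (her : e * r = 2 * A.dim) {ρ : ℂ} (hρ : Polynomial.eval₂ (Int.castRingHom ℂ) ρ P = 0) :
    eigenMultiplicity A φ ρ + eigenMultiplicity A φ (starRingEnd ℂ ρ) = r := by
  haveI := finite_complexBetti_abelianVariety A 1
  have hX : IsSmoothProjective A.dim A.X := Motives.AbelianVariety.isSmoothProjective_holds (A := A)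
  rw [eigenMultiplicity, eigenMultiplicity,
    ← finrank_eigenspace_inf_hodgeZeroOne_eq hX φ.hom.hom.hom (starRingEnd ℂ ρ), Complex.conj_conj,
    ← finrank_eigenspace_eq_add hX φ.hom.hom.hom ρ]
  exact finrank_eigenspace_eq_of_root hPm hPe hPirr hφ her hρ

end Multiplicity

/-! ### Small helpers -/

section Helpers

/-- **One natural number makes `ρ ↦ (x₀ + ρ)ʳ` injective on a finite set** (`r ≥ 1`): for
`ρ ≠ ρ'` the polynomial `(X + ρ)ʳ - (X + ρ')ʳ` does not vanish at `-ρ`, so it has finitely many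
roots; avoid the roots of the product over all pairs. [folklore] -/
theorem exists_nat_add_pow_injOn (Z : Finset ℂ) {r : ℕ} (hr : 0 < r) :
    ∃ x₀ : ℕ, Set.InjOn (fun ρ : ℂ => ((x₀ : ℂ) + ρ) ^ r) (Z : Set ℂ) := by
  classical
  let bad : Finset (ℂ × ℂ) := (Z ×ˢ Z).filter fun p => p.1 ≠ p.2
  let D : ℂ × ℂ → ℂ[X] := fun p => (X + C p.1) ^ r - (X + C p.2) ^ r
  have hD : ∀ p ∈ bad, D p ≠ 0 := by
    intro p hp h0
    have hne : p.1 ≠ p.2 := (Finset.mem_filter.1 hp).2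
    have h := congrArg (Polynomial.eval (-p.1)) h0
    rw [eval_sub, eval_pow, eval_pow, eval_add, eval_add, eval_X, eval_C, eval_C, neg_add_cancel,
      zero_pow hr.ne', zero_sub, eval_zero, neg_eq_zero] at h
    have h' : -p.1 + p.2 = 0 := (pow_eq_zero_iff hr.ne').1 h
    exact hne (by linear_combination -h')
  let Q : ℂ[X] := ∏ p ∈ bad, D p
  have hQ : Q ≠ 0 := Finset.prod_ne_zero_iff.2 hD
  obtain ⟨x₀, hx₀⟩ : ∃ x₀ : ℕ, Q.eval (x₀ : ℂ) ≠ 0 := by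
    by_contra! hall
    apply hQ
    apply Polynomial.eq_zero_of_infinite_isRoot
    refine Set.Infinite.mono ?_ (Set.infinite_range_of_injective Nat.cast_injective)
    rintro _ ⟨x, rfl⟩
    exact hall x
  refine ⟨x₀, fun ρ hρ ρ' hρ' heq => ?_⟩
  dsimp only at heq
  by_contra hne
  have hmem : (ρ, ρ') ∈ bad :=
    Finset.mem_filter.2 ⟨Finset.mem_product.2 ⟨hρ, hρ'⟩, hne⟩
  apply hx₀
  rw [eval_prod]
  refine Finset.prod_eq_zero hmem ?_
  simp only [D, eval_sub, eval_pow, eval_add, eval_X, eval_C, heq, sub_self]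

end Helpers

/-! ### Wedges of eigenvectors are joint eigenclasses -/

section Wedge

variable {A : Motives.AbelianVariety ℂ}

/-- **`w₁ ⌣ ⋯ ⌣ w_r ∈ ⋀ʳ V_ρ`**: an iterated cup product of `ρ`-eigenvectors of `φ^*` on `H¹` is a
joint eigenclass of the test pull-backs `(x·𝟙 + y·φ)^*` with character `(x + yρ)ʳ` (they are ring
maps acting by `x + yρ` on each factor; the step "`⋀^{2n} W` is the invariant subspace" of van
Geemen's proof of Thm. 6.12). [cite: vanGeemen1994HodgeAV, 4.9 and proof of Thm. 6.12] -/
theorem cupPowOne_mem_pullbackEigenclasses_pow (φ : A ⟶ A) {r : ℕ} {ρ : ℂ}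
    {w : Fin r → complexBetti A.X 1}
    (hw : ∀ i, w i ∈ Module.End.eigenspace (complexBetti.map φ.hom.hom.hom 1).hom ρ) :
    cupPowOne ℂ (Motives.ComplexPoints A.X) r w ∈
      pullbackEigenclasses A φ r (fun x y => ((x : ℂ) + (y : ℂ) * ρ) ^ r) := by
  rw [mem_pullbackEigenclasses_iff]
  intro x y
  rw [map_cupPowOne]
  have hfac : (fun i ↦ singularCohomology.map ℂ ℂ
      (Motives.AlgPoints.mapContinuous (L := ℂ) (x • 𝟙 A + y • φ).hom.hom.hom) 1 (w i)) =
      fun i ↦ ((x : ℂ) + (y : ℂ) * ρ) • w i := by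
    funext i
    exact complexBetti_map_nsmul_id_add_nsmul_one_of_mem_eigenspace (hw i) x y
  rw [hfac, MultilinearMap.map_smul_univ, Finset.prod_const, Finset.card_univ, Fintype.card_fin]

end Wedge

/-! ### The rational-line ("all or nothing") lemma -/

section Support

/-- **A rational class spread over distinct eigenvalues of a rational operator, killed by an
irreducible rational polynomial of degree `≥` the number of eigenvalues, and missing one component,
is zero.** Data: a pull-back `T₀ = f^*` on `Hᵏ(X(ℂ); ℂ)`; a finite set `Z ⊂ ℂ` and values `v`
(distinct on `Z` in the application); `c = Σ_{ρ ∈ Z} c_ρ` with `T₀ c_ρ = v(ρ) c_ρ`; `c` rational; `M ∈ ℚ[X]` irreducible with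
`deg M ≥ #Z` and `M(T₀) c = 0`; `c_{ρ₀} = 0` for some `ρ₀ ∈ Z`. Then `c = 0`: the complex annihilator
`Q = ∏_{ρ ≠ ρ₀} (X - v ρ)` of `c` has a rational shadow `Q_φ` (apply a `ℚ`-linear retraction
`ℂ → ℚ` to its coefficients; rational classes form a `ℚ`-structure,
`sum_dual_smul_eq_zero_of_isRationalClass`) with `Q_φ(T₀) c = 0`, `Q_φ ≠ 0`, `deg Q_φ < #Z ≤ deg M`;
so `M ∤ Q_φ`, `M` and `Q_φ` are coprime, and `c = (aM + bQ_φ)(T₀) c = 0`. (Moonen–Zarhin's "all or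
nothing": a non-zero `F`-stable rational subspace of the one-dimensional `F`-space `W_F` is
everything.) [cite: MoonenZarhin1998WeilClasses, §1 (section "all or nothing")] -/
theorem eq_zero_of_isRationalClass_of_eigencomponent_eq_zero {Y : Motives.SchemeOver ℂ} {k : ℕ}
    (f : Y ⟶ Y) (Z : Finset ℂ) (v : ℂ → ℂ)
    (M : Polynomial ℚ) (hMirr : Irreducible M) (hMdeg : Z.card ≤ M.natDegree)
    (comp : ℂ → complexBetti Y k) {c : complexBetti Y k} (hsum : ∑ ρ ∈ Z, comp ρ = c)
    (heig : ∀ ρ ∈ Z, (complexBetti.map f k).hom (comp ρ) = v ρ • comp ρ)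
    (hcQ : IsRationalClass c)
    (hM : aeval (complexBetti.map f k).hom (M.map (algebraMap ℚ ℂ)) c = 0)
    {ρ₀ : ℂ} (hρ₀ : ρ₀ ∈ Z) (hc₀ : comp ρ₀ = 0) : c = 0 := by
  classical
  set T₀ : Module.End ℂ (complexBetti Y k) := (complexBetti.map f k).hom with hT₀
  set e := Z.card with he
  have he1 : 1 ≤ e := Finset.card_pos.2 ⟨ρ₀, hρ₀⟩
  -- the complex annihilator `Q = ∏_{ρ ≠ ρ₀} (X - v ρ)`
  let Q : ℂ[X] := ∏ ρ ∈ Z.erase ρ₀, (X - C (v ρ))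
  have hQm : Q.Monic := monic_prod_of_monic _ _ fun ρ _ => monic_X_sub_C (v ρ)
  have hQdeg : Q.natDegree = e - 1 := by
    rw [natDegree_prod_of_monic _ _ (fun ρ _ => monic_X_sub_C (v ρ))]
    simp only [natDegree_X_sub_C, Finset.sum_const, smul_eq_mul, mul_one]
    rw [Finset.card_erase_of_mem hρ₀]
  have hev : ∀ ρ ∈ Z, ∀ R : ℂ[X], aeval T₀ R (comp ρ) = R.eval (v ρ) • comp ρ := by
    intro ρ hρ R
    by_cases h0 : comp ρ = 0
    · rw [h0, map_zero, smul_zero]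
    · exact Module.End.aeval_apply_of_hasEigenvector
        (Module.End.hasEigenvector_iff.2 ⟨Module.End.mem_eigenspace_iff.2 (heig ρ hρ), h0⟩)
  have hQc : aeval T₀ Q c = 0 := by
    rw [← hsum, map_sum]
    refine Finset.sum_eq_zero fun ρ hρ => ?_
    rw [hev ρ hρ]
    by_cases hρρ : ρ = ρ₀
    · rw [hρρ, hc₀, smul_zero]
    · have h0 : Q.eval (v ρ) = 0 := by
        rw [eval_prod]
        exact Finset.prod_eq_zero (Finset.mem_erase.2 ⟨hρρ, hρ⟩) (by rw [eval_sub, eval_X, eval_C, sub_self])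
      rw [h0, zero_smul]
  -- its rational shadow `Qφ`
  have hTpow : ∀ j : ℕ, IsRationalClass ((T₀ ^ j) c) := fun j =>
    isRationalClass_pow_hom_complexBetti_map f j hcQ
  have hsumQ : ∑ j : Fin e, Q.coeff j • (T₀ ^ (j : ℕ)) c = 0 := by
    have h := hQc
    rw [aeval_eq_sum_range' (show Q.natDegree < e by omega), LinearMap.sum_apply] at h
    rw [← h, ← Finset.sum_range (fun j => Q.coeff j • (T₀ ^ j) c)]
    exact Finset.sum_congr rfl fun j _ => by rw [LinearMap.smul_apply]
  have hshadow := sum_dual_smul_eq_zero_of_isRationalClass (fun j : Fin e => hTpow j) hsumQ ratRetraction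
  let rr : ℕ → ℚ := fun j => ratRetraction (Q.coeff j)
  let Qφ : ℚ[X] := ∑ j ∈ Finset.range e, monomial j (rr j)
  have hQφT : aeval T₀ (Qφ.map (algebraMap ℚ ℂ)) c = 0 := by
    have h1 : aeval T₀ (Qφ.map (algebraMap ℚ ℂ)) c = ∑ j ∈ Finset.range e, ((rr j : ℚ) : ℂ) • (T₀ ^ j) c := by
      rw [Polynomial.map_sum, map_sum, LinearMap.sum_apply]
      refine Finset.sum_congr rfl fun j _ => ?_
      rw [Polynomial.map_monomial, aeval_monomial, eq_ratCast, Algebra.algebraMap_eq_smul_one,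
        smul_mul_assoc, one_mul, LinearMap.smul_apply]
    rw [h1, Finset.sum_range (fun j => ((rr j : ℚ) : ℂ) • (T₀ ^ j) c)]
    exact hshadow
  have hQφ0 : Qφ ≠ 0 := by
    intro h0
    have hc1 : Qφ.coeff (e - 1) = 1 := by
      rw [finsetSum_coeff]
      simp only [coeff_monomial]
      rw [Finset.sum_ite_eq' (Finset.range e) (e - 1) rr, if_pos (Finset.mem_range.2 (by omega))]
      change ratRetraction (Q.coeff (e - 1)) = 1
      rw [← hQdeg, hQm.coeff_natDegree, show (1 : ℂ) = ((1 : ℚ) : ℂ) by norm_num, ratRetraction_ratCast]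
    rw [h0, coeff_zero] at hc1
    exact zero_ne_one hc1
  have hQφdeg : Qφ.natDegree < M.natDegree := by
    have h1 : Qφ.natDegree ≤ e - 1 :=
      natDegree_sum_le_of_forall_le _ _ fun j hj =>
        (natDegree_monomial_le _).trans (by have := Finset.mem_range.1 hj; omega)
    omega
  -- `M ∤ Qφ`, so `M` and `Qφ` are coprime
  have hndvd : ¬ M ∣ Qφ := fun h => absurd (natDegree_le_of_dvd h hQφ0) (not_le.2 hQφdeg)
  obtain ⟨a, b, hab⟩ := (Irreducible.coprime_iff_not_dvd hMirr).2 hndvd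
  have h := congrArg (fun p : ℚ[X] => aeval T₀ (p.map (algebraMap ℚ ℂ)) c) hab
  simp only [Polynomial.map_add, Polynomial.map_mul, Polynomial.map_one, map_add, map_mul, map_one,
    LinearMap.add_apply, Module.End.mul_apply, Module.End.one_apply, hM, hQφT, map_zero, add_zero] at h
  exact h.symm

end Support

/-! ### The summand `⋀ʳ V_ρ` is a line of pure type `(n_ρ, n_ρ̄)` -/

section Line

variable {A : Motives.AbelianVariety ℂ} {φ : A ⟶ A} {P : Polynomial ℤ} {e r : ℕ}

/-- **`⋀ʳ V_ρ = ℂ · ω_ρ` with `ω_ρ ≠ 0` of pure Hodge type `(n_ρ, n_ρ̄)`** (Moonen–Zarhin's display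
`⋀^r V_{ℂ,σ} = ⋀^{n_σ} V^{1,0}_{ℂ,σ} ⊗ ⋀^{n_{σ′}} V^{0,1}_{ℂ,σ}`; Deligne–Milne (4.4) "`⋀^d H_{B,σ}` is of
bidegree `(a_σ, b_σ)`"), on the carriers: `P ∈ ℤ[T]` monic irreducible of degree `e`, `P(φ) = 0`,
`e · r = 2 dim A`, `ρ` a complex root of `P`. Then there is `ω ∈ pullbackEigenclasses A φ r ((x+yρ)ʳ)`,
`ω ≠ 0`, of Hodge type `(eigenMultiplicity A φ ρ, eigenMultiplicity A φ ρ̄)`, and every class of that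
space is a multiple of `ω`. Proof: `ω = u₁ ⌣ ⋯ ⌣ u_{n_ρ} ⌣ v₁ ⌣ ⋯ ⌣ v_{n_ρ̄}` for bases of
`V_ρ ∩ H^{1,0}`, `V_ρ ∩ H^{0,1}` (`dim V_ρ = r`, `finrank_eigenspace_eq_of_root`), non-zero by
`H•(A) = ⋀• H¹`, in the space by `cupPowOne_mem_pullbackEigenclasses_pow`, of that type by
`isOfHodgeType_cupPowOne`; the space has dimension `≤ 1` (`finrank_pullbackEigenclasses_pow_le_one`).
[cite: MoonenZarhin1998WeilClasses, §1 (W_F ⊗ ℂ = ⊕_σ ⋀^{n_σ} V^{1,0} ⊗ ⋀^{n_σ'} V^{0,1})] [cite: Deligne1982HodgeCycles, §4 (4.4)] -/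
theorem exists_generator_pullbackEigenclasses_of_root (hPm : P.Monic) (hPe : P.natDegree = e)
    (hPirr : Irreducible (P.map (Int.castRingHom ℚ)))
    (hφ : Polynomial.eval₂ (Int.castRingHom (CategoryTheory.End A)) (φ : CategoryTheory.End A) P = 0)
    (her : e * r = 2 * A.dim) {ρ : ℂ} (hρ : Polynomial.eval₂ (Int.castRingHom ℂ) ρ P = 0) :
    ∃ ω ∈ pullbackEigenclasses A φ r (fun x y => ((x : ℂ) + (y : ℂ) * ρ) ^ r), ω ≠ 0 ∧
      IsOfHodgeType A.dim A.X r (eigenMultiplicity A φ ρ) (eigenMultiplicity A φ (starRingEnd ℂ ρ)) ω ∧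
      ∀ c ∈ pullbackEigenclasses A φ r (fun x y => ((x : ℂ) + (y : ℂ) * ρ) ^ r), ∃ t : ℂ, c = t • ω := by
  classical
  haveI := finite_complexBetti_abelianVariety A 1
  haveI := finite_complexBetti_abelianVariety A r
  have hX : IsSmoothProjective A.dim A.X := Motives.AbelianVariety.isSmoothProjective_holds (A := A)
  set T := (complexBetti.map φ.hom.hom.hom 1).hom with hT
  set Vp : Submodule ℂ (complexBetti A.X 1) := Module.End.eigenspace T ρ ⊓ hodgeOneZero hX with hVp
  set Vq : Submodule ℂ (complexBetti A.X 1) := Module.End.eigenspace T ρ ⊓ hodgeZeroOne hX with hVq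
  set a := Module.finrank ℂ Vp with ha_def
  set b := Module.finrank ℂ Vq with hb_def
  have ha : eigenMultiplicity A φ ρ = a := rfl
  have hb : eigenMultiplicity A φ (starRingEnd ℂ ρ) = b := by
    change Module.finrank ℂ ↥(Module.End.eigenspace T (starRingEnd ℂ ρ) ⊓ hodgeOneZero hX) = b
    rw [← finrank_eigenspace_inf_hodgeZeroOne_eq hX φ.hom.hom.hom (starRingEnd ℂ ρ), Complex.conj_conj]
  have hdim : Module.finrank ℂ (Module.End.eigenspace T ρ) = r :=
    finrank_eigenspace_eq_of_root hPm hPe hPirr hφ her hρ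
  have hab : a + b = r := by
    rw [← hdim]
    exact (finrank_eigenspace_eq_add hX φ.hom.hom.hom ρ).symm
  -- bases of the two pieces of `V_ρ`, concatenated into `w : Fin r → H¹`
  let bP := Module.finBasis ℂ Vp
  let bQ := Module.finBasis ℂ Vq
  let w₀ : Fin a ⊕ Fin b → complexBetti A.X 1 :=
    Sum.elim (fun i ↦ (bP i : complexBetti A.X 1)) (fun j ↦ (bQ j : complexBetti A.X 1))
  let p₀ : Fin a ⊕ Fin b → ℕ := Sum.elim (fun _ ↦ 1) (fun _ ↦ 0)
  let q₀ : Fin a ⊕ Fin b → ℕ := Sum.elim (fun _ ↦ 0) (fun _ ↦ 1)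
  let ε : Fin r ≃ Fin a ⊕ Fin b := (finCongr hab.symm).trans finSumFinEquiv.symm
  let w : Fin r → complexBetti A.X 1 := w₀ ∘ ε
  have hw_mem : ∀ i, w i ∈ Module.End.eigenspace T ρ := by
    intro i
    change w₀ (ε i) ∈ _
    rcases ε i with j | j
    · exact (Submodule.mem_inf.1 (bP j).2).1
    · exact (Submodule.mem_inf.1 (bQ j).2).1
  have hw_type : ∀ i, IsOfHodgeType A.dim A.X 1 (p₀ (ε i)) (q₀ (ε i)) (w i) := by
    intro i
    change IsOfHodgeType A.dim A.X 1 (p₀ (ε i)) (q₀ (ε i)) (w₀ (ε i))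
    rcases ε i with j | j
    · exact (Submodule.mem_inf.1 (bP j).2).2
    · exact (Submodule.mem_inf.1 (bQ j).2).2
  have hli₀ : LinearIndependent ℂ w₀ := by
    refine LinearIndependent.sum_type ?_ ?_ ?_
    · exact bP.linearIndependent.map' Vp.subtype Vp.ker_subtype
    · exact bQ.linearIndependent.map' Vq.subtype Vq.ker_subtype
    · have hPle : Submodule.span ℂ (Set.range fun i ↦ (bP i : complexBetti A.X 1)) ≤ Vp :=
        Submodule.span_le.2 (by rintro _ ⟨i, rfl⟩; exact (bP i).2)
      have hQle : Submodule.span ℂ (Set.range fun j ↦ (bQ j : complexBetti A.X 1)) ≤ Vq :=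
        Submodule.span_le.2 (by rintro _ ⟨j, rfl⟩; exact (bQ j).2)
      refine Disjoint.mono hPle hQle ?_
      rw [Submodule.disjoint_def]
      intro x hxP hxQ
      exact eq_zero_of_isOfHodgeType_one_zero_of_zero_one hX (Submodule.mem_inf.1 hxP).2
        (Submodule.mem_inf.1 hxQ).2
  have hli : LinearIndependent ℂ w := hli₀.comp ε ε.injective
  -- the generator
  set ω := cupPowOne ℂ (Motives.ComplexPoints A.X) r w with hω
  have hω0 : ω ≠ 0 := cupPowOne_ne_zero_of_linearIndependent A hli
  have hωE : ω ∈ pullbackEigenclasses A φ r (fun x y => ((x : ℂ) + (y : ℂ) * ρ) ^ r) :=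
    cupPowOne_mem_pullbackEigenclasses_pow φ hw_mem
  have hωt : IsOfHodgeType A.dim A.X r a b ω := by
    by_cases hr : r = 0
    · -- degree `0` (`dim A = 0`): `a = b = 0`, and every class of `H⁰` is of type `(0, 0)`
      subst hr
      have ha0 : a = 0 := by omega
      have hb0 : b = 0 := by omega
      rw [ha0, hb0]
      exact isOfHodgeType_zero_zero_of_degree_zero hX ω
    · have h := isOfHodgeType_cupPowOne hX (Nat.pos_of_ne_zero hr) w (p₀ ∘ ε) (q₀ ∘ ε) hw_type
      have hp : ∑ i, (p₀ ∘ ε) i = a := by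
        rw [show (∑ i, (p₀ ∘ ε) i) = ∑ j, p₀ j from ε.sum_comp p₀, Fintype.sum_sum_type]
        simp [p₀]
      have hq : ∑ i, (q₀ ∘ ε) i = b := by
        rw [show (∑ i, (q₀ ∘ ε) i) = ∑ j, q₀ j from ε.sum_comp q₀, Fintype.sum_sum_type]
        simp [q₀]
      rw [hp, hq] at h
      exact h
  -- the joint eigenclass space is a line
  have hsepC : (P.map (Int.castRingHom ℂ)).Separable := by
    rw [map_castRingHom_complex_eq]; exact hPirr.separable.map
  have hF : aeval T (P.map (Int.castRingHom ℂ)) = 0 := aeval_hom_complexBetti_map_one_eq_zero hφ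
  have hss : Module.End.IsSemisimple T :=
    Module.End.isSemisimple_of_squarefree_aeval_eq_zero hsepC.squarefree hF
  have hle1 := (finrank_pullbackEigenclasses_pow_le_one (A := A) (φ := φ) hss (N := r) ρ hdim.le).1
  refine ⟨ω, hωE, hω0, by rw [ha, hb]; exact hωt, fun c hc => ?_⟩
  set E := pullbackEigenclasses A φ r (fun x y => ((x : ℂ) + (y : ℂ) * ρ) ^ r) with hE
  have hpos : 0 < Module.finrank ℂ E := Module.finrank_pos_iff_exists_ne_zero.2 ⟨⟨ω, hωE⟩, fun h =>
    hω0 (congrArg Subtype.val h)⟩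
  have h1 : Module.finrank ℂ E = 1 := le_antisymm hle1 hpos
  obtain ⟨t, ht⟩ := (finrank_eq_one_iff_of_nonzero' (⟨ω, hωE⟩ : E)
    (fun h => hω0 (congrArg Subtype.val h))).1 h1 ⟨c, hc⟩
  exact ⟨t, (congrArg Subtype.val ht).symm⟩

end Line

/-! ### `M(T₀)` kills `W_F ⊗ ℂ` -/

section Annihilator

variable {A : Motives.AbelianVariety ℂ}

/-- **`minpoly_ℚ((x₀ + T)ʳ)((x₀·𝟙 + φ)^*)` kills every class of `W_F ⊗ ℂ`**: on the summand at the
root `ρ` the test pull-back `(x₀·𝟙 + φ)^*` acts by `(x₀ + ρ)ʳ`, a root of that minimal polynomial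
(`aeval_minpoly_pow_eq_zero`, file `WeilClassesFieldRationalSpan`). [cite: MoonenZarhin1998WeilClasses, §1] -/
theorem aeval_minpoly_eq_zero_of_mem_weilClassesField (φ : A ⟶ A) (P : Polynomial ℤ) (x₀ r : ℕ)
    {c : complexBetti A.X r} (hc : c ∈ weilClassesField A φ P r) :
    aeval (complexBetti.map (x₀ • 𝟙 A + 1 • φ).hom.hom.hom r).hom
      ((minpoly ℚ (((x₀ : AdjoinRoot (P.map (Int.castRingHom ℚ))) +
        AdjoinRoot.root (P.map (Int.castRingHom ℚ))) ^ r)).map (algebraMap ℚ ℂ)) c = 0 := by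
  refine Submodule.iSup_induction _ (motive := fun c => aeval (complexBetti.map (x₀ • 𝟙 A + 1 • φ).hom.hom.hom r).hom
      ((minpoly ℚ (((x₀ : AdjoinRoot (P.map (Int.castRingHom ℚ))) +
        AdjoinRoot.root (P.map (Int.castRingHom ℚ))) ^ r)).map (algebraMap ℚ ℂ)) c = 0) hc ?_ ?_ ?_
  · intro ρ x hx
    by_cases hρ : Polynomial.eval₂ (Int.castRingHom ℂ) ρ P = 0
    · rw [iSup_pos (show ρ ∈ {ρ : ℂ | Polynomial.eval₂ (Int.castRingHom ℂ) ρ P = 0} from hρ)] at hx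
      have hT : (complexBetti.map (x₀ • 𝟙 A + 1 • φ).hom.hom.hom r).hom x = (((x₀ : ℂ) + ρ) ^ r) • x := by
        have h := (mem_pullbackEigenclasses_iff.1 hx) x₀ 1
        simp only [Nat.cast_one, one_mul] at h
        exact h
      by_cases hx0 : x = 0
      · rw [hx0, map_zero]
      · rw [Module.End.aeval_apply_of_hasEigenvector
          (Module.End.hasEigenvector_iff.2 ⟨Module.End.mem_eigenspace_iff.2 hT, hx0⟩),
          Polynomial.eval_map, ← aeval_def, aeval_minpoly_pow_eq_zero P x₀ r hρ, zero_smul]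
    · rw [iSup_neg (show ρ ∉ {ρ : ℂ | Polynomial.eval₂ (Int.castRingHom ℂ) ρ P = 0} from hρ),
        Submodule.mem_bot] at hx
      rw [hx, map_zero]
  · exact map_zero _
  · intro x y hx hy
    rw [map_add, hx, hy, add_zero]

end Annihilator

/-! ### The criterion -/

section Criterion

variable {A : Motives.AbelianVariety ℂ} {φ : A ⟶ A} {P : Polynomial ℤ} {e r : ℕ}

/-- **Part (i) of the Criterion**: if `n_ρ = n_ρ̄` for every complex root `ρ` of `P`, every class of
`W_F ⊗ ℂ = weilClassesField A φ P r` is of Hodge type `(r/2, r/2)` — each summand is the line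
`ℂ ω_ρ` of type `(n_ρ, n_ρ̄) = (r/2, r/2)` (`n_ρ + n_ρ̄ = r`).
[cite: MoonenZarhin1998WeilClasses, §1 (Criterion)] [cite: Deligne1982HodgeCycles, Prop. 4.4] -/
theorem isOfHodgeType_of_mem_weilClassesField_of_balanced (hPm : P.Monic) (hPe : P.natDegree = e)
    (hPirr : Irreducible (P.map (Int.castRingHom ℚ)))
    (hφ : Polynomial.eval₂ (Int.castRingHom (CategoryTheory.End A)) (φ : CategoryTheory.End A) P = 0)
    (her : e * r = 2 * A.dim)
    (hbal : ∀ ρ : ℂ, Polynomial.eval₂ (Int.castRingHom ℂ) ρ P = 0 →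
      eigenMultiplicity A φ ρ = eigenMultiplicity A φ (starRingEnd ℂ ρ))
    {c : complexBetti A.X r} (hc : c ∈ weilClassesField A φ P r) :
    IsOfHodgeType A.dim A.X r (r / 2) (r / 2) c := by
  have hX : IsSmoothProjective A.dim A.X := Motives.AbelianVariety.isSmoothProjective_holds (A := A)
  obtain ⟨Am⟩ := nonempty_hodgeModel_holds.nonempty hX
  refine Submodule.iSup_induction _ (motive := fun c => IsOfHodgeType A.dim A.X r (r / 2) (r / 2) c) hc
    ?_ (IsOfHodgeType.zero Am _ _ _) (fun x y hx hy => hx.add hX hy)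
  intro ρ x hx
  by_cases hρ : Polynomial.eval₂ (Int.castRingHom ℂ) ρ P = 0
  · rw [iSup_pos (show ρ ∈ {ρ : ℂ | Polynomial.eval₂ (Int.castRingHom ℂ) ρ P = 0} from hρ)] at hx
    obtain ⟨ω, -, -, hωt, hgen⟩ := exists_generator_pullbackEigenclasses_of_root hPm hPe hPirr hφ her hρ
    obtain ⟨t, rfl⟩ := hgen x hx
    have hsum := eigenMultiplicity_add_eigenMultiplicity_conj_eq hPm hPe hPirr hφ her hρ
    have heq := hbal ρ hρ
    have h1 : eigenMultiplicity A φ ρ = r / 2 := by omega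
    have h2 : eigenMultiplicity A φ (starRingEnd ℂ ρ) = r / 2 := by omega
    rw [h1, h2] at hωt
    exact hωt.smul t
  · rw [iSup_neg (show ρ ∉ {ρ : ℂ | Polynomial.eval₂ (Int.castRingHom ℂ) ρ P = 0} from hρ),
      Submodule.mem_bot] at hx
    rw [hx]
    exact IsOfHodgeType.zero Am _ _ _

/-- **Part (ii) of the Criterion**: if `n_{ρ₁} ≠ n_{ρ̄₁}` for some complex root `ρ₁` of `P`, every
RATIONAL class of `W_F ⊗ ℂ` of Hodge type `(r/2, r/2)` vanishes. The component of such a class `c` on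
the summand at `ρ₁` (pure type `(n_{ρ₁}, n_{ρ̄₁}) ≠ (r/2, r/2)`) vanishes by the Hodge decomposition
(type projectors), and a rational class of `W_F ⊗ ℂ` with one vanishing component is zero
(`eq_zero_of_isRationalClass_of_eigencomponent_eq_zero` — Moonen–Zarhin's "all or nothing").
[cite: MoonenZarhin1998WeilClasses, §1 (Criterion and "all or nothing")] [cite: Deligne1982HodgeCycles, Prop. 4.4] -/
theorem eq_zero_of_mem_weilClassesField_of_unbalanced (hPm : P.Monic) (hPe : P.natDegree = e)
    (hPirr : Irreducible (P.map (Int.castRingHom ℚ)))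
    (hφ : Polynomial.eval₂ (Int.castRingHom (CategoryTheory.End A)) (φ : CategoryTheory.End A) P = 0)
    (her : e * r = 2 * A.dim)
    (hunb : ∃ ρ : ℂ, Polynomial.eval₂ (Int.castRingHom ℂ) ρ P = 0 ∧
      eigenMultiplicity A φ ρ ≠ eigenMultiplicity A φ (starRingEnd ℂ ρ))
    {c : complexBetti A.X r} (hc : c ∈ weilClassesField A φ P r) (hcQ : IsRationalClass c)
    (hcH : IsOfHodgeType A.dim A.X r (r / 2) (r / 2) c) : c = 0 := by
  classical
  obtain ⟨ρ₁, hρ₁, hne⟩ := hunb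
  have hX : IsSmoothProjective A.dim A.X := Motives.AbelianVariety.isSmoothProjective_holds (A := A)
  haveI := finite_complexBetti_abelianVariety A r
  have hsum₁ := eigenMultiplicity_add_eigenMultiplicity_conj_eq hPm hPe hPirr hφ her hρ₁
  -- off the antidiagonal the type is empty
  by_cases hrr : r / 2 + r / 2 = r
  swap
  · -- there are no `r`-classes of type `(r/2, r/2)` (`hodgePQ_eq_bot_of_ne`)
    obtain ⟨B, hB⟩ := hcH
    have hbot : B.hodgePQ r (r / 2) (r / 2) = ⊥ :=
      (B.hodgePQ_eq_bot_iff r (r / 2) (r / 2)).2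
        (Literature.NumberTheory.Transcendental.hodgePQ_eq_bot_of_ne hrr)
    rw [hbot, Submodule.mem_bot] at hB
    exact B.pullback_injective r (by rw [hB, map_zero])
  have hr0 : 0 < r := by omega
  -- the finite set of roots, of cardinality `e`
  have hP0 : P ≠ 0 := hPm.ne_zero
  have hPC0 : P.map (Int.castRingHom ℂ) ≠ 0 :=
    (Polynomial.map_ne_zero_iff (RingHom.injective_int (Int.castRingHom ℂ))).2 hP0
  have hsepC : (P.map (Int.castRingHom ℂ)).Separable := by
    rw [map_castRingHom_complex_eq]; exact hPirr.separable.map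
  let Z : Finset ℂ := (P.map (Int.castRingHom ℂ)).roots.toFinset
  have hZ : ∀ μ, μ ∈ Z ↔ Polynomial.eval₂ (Int.castRingHom ℂ) μ P = 0 := mem_roots_toFinset_map_iff hP0
  have hZcard : Z.card = e := by
    rw [Multiset.toFinset_card_of_nodup (nodup_roots hsepC), IsAlgClosed.card_roots_eq_natDegree,
      natDegree_map_eq_of_injective (RingHom.injective_int _), hPe]
  -- a separating test endomorphism `x₀·𝟙 + φ`
  obtain ⟨x₀, hinj⟩ := exists_nat_add_pow_injOn Z hr0
  set T₀ : Module.End ℂ (complexBetti A.X r) :=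
    (complexBetti.map (x₀ • 𝟙 A + 1 • φ).hom.hom.hom r).hom with hT₀
  -- the decomposition of `c` along the roots
  have hW : weilClassesField A φ P r =
      ⨆ ρ ∈ Z, pullbackEigenclasses A φ r (fun x y => ((x : ℂ) + (y : ℂ) * ρ) ^ r) := by
    apply le_antisymm
    · exact iSup₂_le fun ρ hρ => le_iSup₂_of_le (f := fun ρ (_ : ρ ∈ Z) =>
        pullbackEigenclasses A φ r (fun x y => ((x : ℂ) + (y : ℂ) * ρ) ^ r)) ρ ((hZ ρ).2 hρ) le_rfl
    · exact iSup₂_le fun ρ hρ => pullbackEigenclasses_le_weilClassesField ((hZ ρ).1 hρ)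
  rw [hW] at hc
  obtain ⟨μ, hμ⟩ := (Submodule.mem_iSup_finset_iff_exists_sum _ c).1 hc
  let comp : ℂ → complexBetti A.X r := fun ρ => (μ ρ : complexBetti A.X r)
  have hcomp_mem : ∀ ρ, comp ρ ∈ pullbackEigenclasses A φ r (fun x y => ((x : ℂ) + (y : ℂ) * ρ) ^ r) :=
    fun ρ => (μ ρ).2
  have hμ' : ∑ ρ ∈ Z, comp ρ = c := hμ
  have heig : ∀ ρ ∈ Z, T₀ (comp ρ) = (((x₀ : ℂ) + ρ) ^ r) • comp ρ := by
    intro ρ _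
    have h := (mem_pullbackEigenclasses_iff.1 (hcomp_mem ρ)) x₀ 1
    simp only [Nat.cast_one, one_mul] at h
    exact h
  -- each component is a multiple of the generator `ω_ρ`, of pure type `(n_ρ, n_ρ̄)`
  have htype : ∀ ρ ∈ Z, IsOfHodgeType A.dim A.X r (eigenMultiplicity A φ ρ)
      (eigenMultiplicity A φ (starRingEnd ℂ ρ)) (comp ρ) := by
    intro ρ hρ
    obtain ⟨ω, -, -, hωt, hgen⟩ :=
      exists_generator_pullbackEigenclasses_of_root hPm hPe hPirr hφ her ((hZ ρ).1 hρ)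
    obtain ⟨t, ht⟩ := hgen _ (hcomp_mem ρ)
    rw [ht]
    exact hωt.smul t
  -- the Hodge bookkeeping: the component of `c` at `ρ₁` vanishes
  obtain ⟨Am⟩ := nonempty_hodgeModel_holds.nonempty hX
  let τ : ℂ → ↥(Finset.HasAntidiagonal.antidiagonal r) := fun ρ =>
    if h : ρ ∈ Z then ⟨(eigenMultiplicity A φ ρ, eigenMultiplicity A φ (starRingEnd ℂ ρ)),
      Finset.HasAntidiagonal.mem_antidiagonal.2
        (eigenMultiplicity_add_eigenMultiplicity_conj_eq hPm hPe hPirr hφ her ((hZ ρ).1 h))⟩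
    else ⟨(r / 2, r / 2), Finset.HasAntidiagonal.mem_antidiagonal.2 hrr⟩
  have hτ : ∀ ρ ∈ Z, comp ρ ∈ Am.typePiece r (τ ρ) := by
    intro ρ hρ
    have hτρ : τ ρ = ⟨(eigenMultiplicity A φ ρ, eigenMultiplicity A φ (starRingEnd ℂ ρ)),
        Finset.HasAntidiagonal.mem_antidiagonal.2
          (eigenMultiplicity_add_eigenMultiplicity_conj_eq hPm hPe hPirr hφ her ((hZ ρ).1 hρ))⟩ :=
      dif_pos hρ
    rw [hτρ]
    exact Am.mem_typePiece_of_isOfHodgeType hodgePQ_independent_of_hodgeModel_holds hX _ (htype ρ hρ)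
  let y : ↥(Finset.HasAntidiagonal.antidiagonal r) → complexBetti A.X r :=
    fun pq => ∑ ρ ∈ Z with τ ρ = pq, comp ρ
  have hy : ∀ pq, y pq ∈ Am.typePiece r pq := by
    intro pq
    refine Submodule.sum_mem _ fun ρ hρ => ?_
    obtain ⟨hρZ, hρpq⟩ := Finset.mem_filter.1 hρ
    rw [← hρpq]
    exact hτ ρ hρZ
  have hysum : ∑ pq, y pq = c := by
    rw [← hμ']
    exact Finset.sum_fiberwise Z τ comp
  let pq₁ : ↥(Finset.HasAntidiagonal.antidiagonal r) :=
    ⟨(eigenMultiplicity A φ ρ₁, eigenMultiplicity A φ (starRingEnd ℂ ρ₁)),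
      Finset.HasAntidiagonal.mem_antidiagonal.2 hsum₁⟩
  let pqc : ↥(Finset.HasAntidiagonal.antidiagonal r) :=
    ⟨(r / 2, r / 2), Finset.HasAntidiagonal.mem_antidiagonal.2 hrr⟩
  have hne₁ : pqc ≠ pq₁ := by
    intro h
    have h' := congrArg (fun t : ↥(Finset.HasAntidiagonal.antidiagonal r) => t.1) h
    change (r / 2, r / 2) = (eigenMultiplicity A φ ρ₁, eigenMultiplicity A φ (starRingEnd ℂ ρ₁)) at h'
    rw [Prod.mk.injEq] at h'
    exact hne (h'.1.symm.trans h'.2)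
  have hcpiece : c ∈ Am.typePiece r pqc :=
    Am.mem_typePiece_of_isOfHodgeType hodgePQ_independent_of_hodgeModel_holds hX _ hcH
  have hy₁ : y pq₁ = 0 := by
    rw [← Am.typeProj_eq_of_sum_eq hy hysum pq₁]
    exact Am.typeProj_apply_of_mem_ne hne₁ hcpiece
  -- the summands at `pq₁` are eigenvectors for distinct eigenvalues: the component at `ρ₁` vanishes
  have hρ₁Z : ρ₁ ∈ Z := (hZ ρ₁).2 hρ₁
  have hτ₁ : τ ρ₁ = pq₁ := dif_pos hρ₁Z
  have hcomp₁ : comp ρ₁ = 0 := by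
    set S₁ : Finset ℂ := Z.filter (fun ρ => τ ρ = pq₁) with hS₁
    have hρ₁S : ρ₁ ∈ S₁ := Finset.mem_filter.2 ⟨hρ₁Z, hτ₁⟩
    let R : ℂ[X] := ∏ ρ ∈ S₁.erase ρ₁, (Polynomial.X - C (((x₀ : ℂ) + ρ) ^ r))
    have hev : ∀ ρ ∈ Z, aeval T₀ R (comp ρ) = R.eval (((x₀ : ℂ) + ρ) ^ r) • comp ρ := by
      intro ρ hρ
      by_cases h0 : comp ρ = 0
      · rw [h0, map_zero, smul_zero]
      · exact Module.End.aeval_apply_of_hasEigenvector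
          (Module.End.hasEigenvector_iff.2 ⟨Module.End.mem_eigenspace_iff.2 (heig ρ hρ), h0⟩)
    have h := congrArg (aeval T₀ R) hy₁
    rw [map_zero, map_sum] at h
    rw [Finset.sum_eq_single_of_mem ρ₁ hρ₁S] at h
    · rw [hev ρ₁ hρ₁Z] at h
      have hR : R.eval (((x₀ : ℂ) + ρ₁) ^ r) ≠ 0 := by
        rw [eval_prod]
        refine Finset.prod_ne_zero_iff.2 fun ρ hρ => ?_
        obtain ⟨hρρ, hρS⟩ := Finset.mem_erase.1 hρ
        rw [eval_sub, eval_X, eval_C, sub_ne_zero]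
        exact fun heq => hρρ (hinj (Finset.mem_filter.1 hρS).1 hρ₁Z heq.symm)
      exact (smul_eq_zero.1 h).resolve_left hR
    · intro ρ hρS hρρ
      rw [hev ρ (Finset.mem_filter.1 hρS).1]
      have h0 : R.eval (((x₀ : ℂ) + ρ) ^ r) = 0 := by
        rw [eval_prod]
        exact Finset.prod_eq_zero (Finset.mem_erase.2 ⟨hρρ, hρS⟩) (by rw [eval_sub, eval_X, eval_C, sub_self])
      rw [h0, zero_smul]
  -- the irreducible rational polynomial `M = minpoly_ℚ((x₀ + T)ʳ)` kills `c` and has degree `≥ e`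
  haveI : Fact (Irreducible (P.map (Int.castRingHom ℚ))) := ⟨hPirr⟩
  haveI : FiniteDimensional ℚ (AdjoinRoot (P.map (Int.castRingHom ℚ))) :=
    (AdjoinRoot.powerBasis hPirr.ne_zero).finite
  set g : AdjoinRoot (P.map (Int.castRingHom ℚ)) :=
    ((x₀ : AdjoinRoot (P.map (Int.castRingHom ℚ))) + AdjoinRoot.root (P.map (Int.castRingHom ℚ))) ^ r
    with hg
  have hgint : IsIntegral ℚ g := Algebra.IsIntegral.isIntegral g
  have hMirr : Irreducible (minpoly ℚ g) := minpoly.irreducible hgint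
  have hM0 : (minpoly ℚ g).map (algebraMap ℚ ℂ) ≠ 0 :=
    (Polynomial.map_ne_zero_iff (algebraMap ℚ ℂ).injective).2 (minpoly.ne_zero hgint)
  have hMdeg : Z.card ≤ (minpoly ℚ g).natDegree := by
    have himage : Z.image (fun ρ : ℂ => ((x₀ : ℂ) + ρ) ^ r) ⊆ ((minpoly ℚ g).map (algebraMap ℚ ℂ)).roots.toFinset := by
      intro z hz
      obtain ⟨ρ, hρ, rfl⟩ := Finset.mem_image.1 hz
      rw [Multiset.mem_toFinset, mem_roots hM0, IsRoot.def, Polynomial.eval_map, ← aeval_def, hg]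
      exact aeval_minpoly_pow_eq_zero P x₀ r ((hZ ρ).1 hρ)
    calc Z.card = (Z.image (fun ρ : ℂ => ((x₀ : ℂ) + ρ) ^ r)).card := (Finset.card_image_of_injOn hinj).symm
      _ ≤ ((minpoly ℚ g).map (algebraMap ℚ ℂ)).roots.toFinset.card := Finset.card_le_card himage
      _ ≤ ((minpoly ℚ g).map (algebraMap ℚ ℂ)).roots.card := Multiset.toFinset_card_le _
      _ ≤ ((minpoly ℚ g).map (algebraMap ℚ ℂ)).natDegree := Polynomial.card_roots' _
      _ = (minpoly ℚ g).natDegree := natDegree_map _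
  have hMc : aeval T₀ ((minpoly ℚ g).map (algebraMap ℚ ℂ)) c = 0 := by
    rw [hg]
    exact aeval_minpoly_eq_zero_of_mem_weilClassesField φ P x₀ r (hW ▸ hc)
  exact eq_zero_of_isRationalClass_of_eigencomponent_eq_zero (x₀ • 𝟙 A + 1 • φ).hom.hom.hom Z
    (fun ρ : ℂ => ((x₀ : ℂ) + ρ) ^ r) (minpoly ℚ g) hMirr hMdeg comp hμ' heig hcQ hMc hρ₁Z hcomp₁

/-- **Moonen–Zarhin's Hodge criterion for Weil classes, DISCHARGED**: the named fact
`MoonenZarhin1998_weilClasses_hodgeCriterion` (file `WeilClassesMoonenZarhinCriterion`) holds — for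
a complex abelian variety `A`, `φ : A ⟶ A`, `P ∈ ℤ[T]` monic of degree `e`, irreducible over `ℚ`,
`P(φ) = 0`, `e · r = 2 dim A`: (i) if `n_ρ = n_ρ̄` for all complex roots `ρ` of `P`, every class of
`W_F ⊗ ℂ` is of Hodge type `(r/2, r/2)`; (ii) if `n_ρ ≠ n_ρ̄` for some root, every rational
`(r/2, r/2)`-class of `W_F ⊗ ℂ` is zero. [cite: MoonenZarhin1998WeilClasses, §1 (Criterion)] [cite: Deligne1982HodgeCycles, Prop. 4.4] -/
theorem MoonenZarhin1998_weilClasses_hodgeCriterion_holds : MoonenZarhin1998_weilClasses_hodgeCriterion := by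
  intro A φ P e r hPm hPe hPirr hφ her
  exact ⟨fun hbal c hc => isOfHodgeType_of_mem_weilClassesField_of_balanced hPm hPe hPirr hφ her hbal hc,
    fun hunb c hc hcQ hcH => eq_zero_of_mem_weilClassesField_of_unbalanced hPm hPe hPirr hφ her hunb hc hcQ hcH⟩

end Criterion

end HodgeTheory

end Literature.AlgebraicGeometry.HodgeTheory
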